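import Mathlib
import Summits.NavierStokesRegularity.OSWSelfSimilar.SheetNSLineTorusCascadeCellChecker
import HarnessLib

/-!
# Viscous CLM on the torus (`a = 0`, `σ = 2`): the reflective cell-chain checker — run for a BRACKETED REAL DATUM, CHUNKED
# kernel evaluation, and the dyadic helpers `xloAfter` / `powUp` (definitions only)

HONEST FRAMING (cell ns-blowup GROUP B «PROFILE SEARCH», zone Z3, row Z3-U addendum A-F2 of `HOME/profile/z3/CENSUS-Z3.md`;
human rulings D-0035/D-0074; Z3-TWIN lineage, eng-5 g13): **1-D MODEL; computable definitions over `ℕ` evaluated by the kernel in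
instance files; not Euler, not Navier–Stokes; «violates: none — MODEL».**

* `initB` / `runB` — `CellChain.run` of `SheetNSLineTorusCascadeCellChecker` for a REAL datum `c` bracketed by `xlo₀ ≤ 2^P c ≤ xhi₀`
  (`run_eq_runB`: `run` is the natural-datum case);
* `St.toT` / `St.ofT` (+ `St.ofT_toT`, `St.eq_ofT_of_toT_eq`), `runSeg_add` / `runSeg_split`, `runB_three` — a run is evaluated in
  CHUNKS of cells (one `decide` per chunk, intermediate states as tuple literals), then recomposed by rewriting;
* `xloAfter` (mode `1` stepped `n` cells, rounded down) and `powUp` (a power of `q = a/2^j`, rounded up).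
Soundness of all of this: `SheetNSLineTorusCascadeCellCheckerMain` (`runB_sound`). bears_on: LADDER-NS N5 / zone Z3 (row Z3-U) →
N1 linear core. WHAT THIS IS NOT: not NS; no number certified by THIS file.
-/

namespace Summit.NavierStokesRegularity.OSWSelfSimilar
namespace SheetNSLineTorusCascade
namespace CellChain

/-- Initial state with an arbitrary mode-1 bracket `xlo₀ ≤ D·c ≤ xhi₀` (real datum `c`). [new here — MODEL] -/
def initB (K xlo₀ xhi₀ B : ℕ) : St :=
  { xlo := xlo₀, xhi := xhi₀, lo := zeros (K - 1), up := zeros (K - 1), usup := zeros (K - 1), linf := consts B (K - 1),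
    idx := 0 }

/-- **The certificate run for a bracketed real datum**: `(usup, linf)` for the modes `2…K`. [new here — MODEL] -/
def runB (P K xlo₀ xhi₀ B w₁ w₂ : ℕ) (segs : List Seg) : List ℕ × List ℕ :=
  let st := runAll P K w₁ w₂ segs (initB K xlo₀ xhi₀ B)
  (zipMax st.usup (rayLoop (2 ^ P) st.up 2 [st.xhi] [st.xhi]), st.linf)

/-- `run` is `runB` with the exact bracket of a natural datum. [new here — MODEL] -/
theorem run_eq_runB (P K c₀ B w₁ w₂ : ℕ) (segs : List Seg) :
    run P K c₀ B w₁ w₂ segs = runB P K (c₀ * 2 ^ P) (c₀ * 2 ^ P) B w₁ w₂ segs := rfl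

/-- The state as a tuple (for kernel evaluation in CHUNKS: tuples have decidable equality). [new here — MODEL] -/
def St.toT (st : St) : ℕ × ℕ × List ℕ × List ℕ × List ℕ × List ℕ × ℕ :=
  (st.xlo, st.xhi, st.lo, st.up, st.usup, st.linf, st.idx)

/-- The state from a tuple. [new here — MODEL] -/
def St.ofT (T : ℕ × ℕ × List ℕ × List ℕ × List ℕ × List ℕ × ℕ) : St :=
  { xlo := T.1, xhi := T.2.1, lo := T.2.2.1, up := T.2.2.2.1, usup := T.2.2.2.2.1, linf := T.2.2.2.2.2.1, idx := T.2.2.2.2.2.2 }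

/-- `St.ofT` inverts `St.toT`. [folklore] -/
theorem St.ofT_toT (st : St) : St.ofT st.toT = st := by cases st; rfl

/-- A chunk equation read back as a state equation: `(X).toT = T` gives `X = St.ofT T`. [folklore] -/
theorem St.eq_ofT_of_toT_eq {st : St} {T : ℕ × ℕ × List ℕ × List ℕ × List ℕ × List ℕ × ℕ} (h : st.toT = T) :
    st = St.ofT T := by rw [← h, St.ofT_toT]

/-- **Chunking of a segment:** `m + n` cells = `n` cells, then `m` cells. [folklore] -/
theorem runSeg_add (D a j w₁ w₂ : ℕ) (rho : List ℕ) (m : ℕ) :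
    ∀ (n : ℕ) (st : St), runSeg D a j w₁ w₂ rho (m + n) st = runSeg D a j w₁ w₂ rho m (runSeg D a j w₁ w₂ rho n st)
  | 0, st => rfl
  | n + 1, st => by rw [← Nat.add_assoc, runSeg, runSeg, runSeg_add D a j w₁ w₂ rho m n]

/-- `runSeg_add` keyed on the total: with `m + n = N`, `N` cells = `n` cells then `m` cells. [folklore] -/
theorem runSeg_split {N m n : ℕ} (h : m + n = N) (D a j w₁ w₂ : ℕ) (rho : List ℕ) (st : St) :
    runSeg D a j w₁ w₂ rho N st = runSeg D a j w₁ w₂ rho m (runSeg D a j w₁ w₂ rho n st) := by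
  subst h; exact runSeg_add D a j w₁ w₂ rho m n st

/-- `runB` on three segments, unfolded (the shape the chunk equations of an instance file rewrite). [new here — MODEL] -/
theorem runB_three (P K xlo₀ xhi₀ B w₁ w₂ a₁ j₁ n₁ a₂ j₂ n₂ a₃ j₃ n₃ : ℕ) :
    runB P K xlo₀ xhi₀ B w₁ w₂ [⟨a₁, j₁, n₁⟩, ⟨a₂, j₂, n₂⟩, ⟨a₃, j₃, n₃⟩] =
      (zipMax (runSeg (2 ^ P) a₃ j₃ w₁ w₂ (rhos P a₃ j₃ (K - 1) 2) n₃ (runSeg (2 ^ P) a₂ j₂ w₁ w₂ (rhos P a₂ j₂ (K - 1) 2) n₂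
          (runSeg (2 ^ P) a₁ j₁ w₁ w₂ (rhos P a₁ j₁ (K - 1) 2) n₁ (initB K xlo₀ xhi₀ B)))).usup
        (rayLoop (2 ^ P) (runSeg (2 ^ P) a₃ j₃ w₁ w₂ (rhos P a₃ j₃ (K - 1) 2) n₃ (runSeg (2 ^ P) a₂ j₂ w₁ w₂ (rhos P a₂ j₂ (K - 1) 2) n₂
          (runSeg (2 ^ P) a₁ j₁ w₁ w₂ (rhos P a₁ j₁ (K - 1) 2) n₁ (initB K xlo₀ xhi₀ B)))).up 2
          [(runSeg (2 ^ P) a₃ j₃ w₁ w₂ (rhos P a₃ j₃ (K - 1) 2) n₃ (runSeg (2 ^ P) a₂ j₂ w₁ w₂ (rhos P a₂ j₂ (K - 1) 2) n₂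
            (runSeg (2 ^ P) a₁ j₁ w₁ w₂ (rhos P a₁ j₁ (K - 1) 2) n₁ (initB K xlo₀ xhi₀ B)))).xhi]
          [(runSeg (2 ^ P) a₃ j₃ w₁ w₂ (rhos P a₃ j₃ (K - 1) 2) n₃ (runSeg (2 ^ P) a₂ j₂ w₁ w₂ (rhos P a₂ j₂ (K - 1) 2) n₂
            (runSeg (2 ^ P) a₁ j₁ w₁ w₂ (rhos P a₁ j₁ (K - 1) 2) n₁ (initB K xlo₀ xhi₀ B)))).xhi]),
       (runSeg (2 ^ P) a₃ j₃ w₁ w₂ (rhos P a₃ j₃ (K - 1) 2) n₃ (runSeg (2 ^ P) a₂ j₂ w₁ w₂ (rhos P a₂ j₂ (K - 1) 2) n₂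
          (runSeg (2 ^ P) a₁ j₁ w₁ w₂ (rhos P a₁ j₁ (K - 1) 2) n₁ (initB K xlo₀ xhi₀ B)))).linf) := rfl

/-- Mode `1` stepped `n` cells DOWNWARD-rounded: `x ↦ ⌊x·a/2^j⌋`. [new here — MODEL] -/
def xloAfter (a j : ℕ) : ℕ → ℕ → ℕ
  | 0, x => x
  | n + 1, x => xloAfter a j n ((x * a) >>> j)

/-- A power of `q = a/2^j` UPWARD-rounded: `x ↦ ⌈x·a/2^j⌉`, `n` times. [new here — MODEL] -/
def powUp (a j : ℕ) : ℕ → ℕ → ℕ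
  | 0, x => x
  | n + 1, x => powUp a j n (cdiv (x * a) (2 ^ j))

end CellChain
end SheetNSLineTorusCascade
end Summit.NavierStokesRegularity.OSWSelfSimilar
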